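/-
Copyright (c) 2026 the pub-hodgecm-mathlib formalisation cell (harness21).  Prover seat hodgecm-mathlib-LH4-p09 (g2), req620 Track A «(D-RAM) FOUR-FRAME» squad
(unit U3_Laws, (R-17) «NI2 ⊕ MS»; brick «NI2-LOWER» raised by refuter LH-ref2 (g8) 22:55:50Z): a σ-FIXED UNIT WHICH IS NOT A NORM exists at every ramified quadratic
datum — so the local norm index is EXACTLY two, and the NI2 witness `c` is a non-norm.  One-field datum currency.  2026-09-03.
-/
import Literature.NumberTheory.LocalFields.WildQuadraticDatumUnitNormIndexTwo   -- ★ p855374 (this seat, LEG 2): the unit dichotomy; brings ★ p855352 LEG 1 (graded steps), ★ p854729 deep norms, ★ B-p10 tame criterion, ★ datum toolkit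
import HarnessLib

/-!
# A σ-fixed unit which is NOT a norm, at every ramified quadratic datum: `[U_F : N U_E] ≥ 2`, hence `= 2` with the NI2 witness a non-norm
# (Serre, *Local Fields* V §3 Prop. 5 (iii) and Cor. 3: at the break the graded norm map `ξ ↦ ξ² + η̄ξ` has cokernel of order EXACTLY `p = 2`)

Topic `NumberTheory/LocalFields`; namespace `Literature.NumberTheory.LocalFields.WildQuadraticDatum` (the one-field datum ★ `IsRamifiedQuadraticDatum σ ϖ d t`: `σ` an involution
of a discretely valued field `K` with `v ∘ σ = v`, non-zero `σ`-fixed elements of even valuation, `ϖ` a uniformiser, `|ϖ − σϖ| = |ϖ|^d ≥ 1`, `|2| = |ϖ|^t`; the fixed field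
`F = K^σ` is never a type).  THEOREMS ONLY (no definition, no instance, no notation, no named fact, no `sorry`).  Cell `pub/hodgecm-mathlib` (D-0151), crux H413 =
`stmt-HodgeConjecture-24833`; road «(D-RAM) FOUR-FRAME», unit U3_Laws.  WHY: the registered stub `stub_U3_normIndexTwo` (PAID, U3 ED. 5, ★ p855402 over ★ p855374) and the
(MS) stub quantify a `σ`-fixed unit `c` with the DICHOTOMY `∀ x ≠ 0 fixed, x ∈ N ∨ c·x ∈ N` only — index `≤ 2`; the MS payer through bricks M∕O (unit-triple norm index
`8`, orbit count) also needs `c ∉ N` (LH-ref2 (g8) input flag «NI2-LOWER»: the branch «c is a norm» cannot be discharged vacuously without a non-norm fixed unit IN DATUM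
CURRENCY, which the tree had only at TAME places, ★ B-p10).  This file supplies it at every datum and upgrades NI2 to INDEX EXACTLY TWO.

THE MATHEMATICS (`π := ϖσϖ`, `N z := zσz`, `d = n + 1`).
* §1 THE BREAK-LEVEL TRACE COEFFICIENT IS A UNIT: `|Tr(ϖⁿ)| = |π|ⁿ` exactly (`λ̄ ≠ 0` in LEG 1 §3).  By ★ `exists_v_le_add_map_eq` (surjectivity `Tr 𝔭_E^{d−1} = 𝔭_F^{d−1}`,
  Serre III §3 Prop. 7) some `g = aϖⁿ + e·ϖⁿ` (`a` fixed, `|e| ≤ |ϖ|`) has `Tr g = πⁿ`; `Tr(eϖⁿ) ∈ 𝔭_F^{d}` (★ `v_add_map_le_exp`), so `|a·Tr ϖⁿ| = |π|ⁿ`.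
* §2 WILD (`|2| < 1`, so `d ≥ 2`, `char 𝓀 = 2`): the residue map `φ(ȳ) = ȳ² + λ̄ȳ` (`λ = Tr(ϖⁿ)∕πⁿ`) kills `λ̄ ≠ 0`, so it is not injective, so NOT ONTO the finite `𝓀`; pick a fixed
  integer `w` with `w̄ ∉ im φ` and put `u := 1 + w·πⁿ`.  If `zσz = u`: `|z| = 1` and `z ≡ 1 (mod 𝔪)` (`a₀² ≡ 1 ⇒ a₀ ≡ 1` in characteristic `2`, `a₀` the fixed part of `z`);
  the level of `x := z − 1` is `≥ n` (at a level `m ≤ n − 1 = d − 2` the trace is negligible, ★ `v_add_map_le_exp`, so `|N z − 1| = |x|² = |π|^m > |π|ⁿ ≥ |u − 1|`); and at level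
  `n`, writing `x = (a + e)ϖⁿ` (`a` fixed, `|e| ≤ |ϖ|`), `N z − 1 = Tr x + N x = a·Tr(ϖⁿ) + a²πⁿ + O(π^{n+1})`, i.e. `w ≡ a² + λa (mod 𝔪)` — `w̄ = φ(ā)`, contradiction.
  (Serre V §3 Prop. 5 (iii) read contrapositively; NO completeness used.)
* §3 TAME (`|2| = 1`): ★ B-p10 `RamifiedQuadraticNorm.exists_fixed_isUnit_not_exists_mul_map_eq` on `𝒪[K]` with `σO := (σ.comp 𝒪[K].subtype).codRestrict 𝒪[K]` (residually
  trivial by ★ `exists_fixed_v_sub_le`), lifted to `K` (`|zσz| = 1 ⇒ z ∈ 𝒪[K]`).  §4 every datum (`t = 0` ∕ `t ≥ 1`).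
* §5 THE UPGRADE of ★ p855374 ∕ ★ p855402: any non-norm fixed unit `u₀` forces the NI2 witness `c` to be a non-norm (`c·u₀ = N z`, `c = N y ⇒ u₀ = N(z∕y)`), so
  `∃ c ∈ U_F, c ∉ N(K^×) ∧ ∀ u ∈ U_F, u ∈ N ∨ c·u ∈ N` and, with datum clause 4 (`|x| = exp 2m`, `x = N(ϖ^m)·u`), the same for all non-zero fixed `x`: `[F^× : N K^×] = 2` ON THE NOSE.
HONEST LABEL: HC_CM is proved only modulo the 7 printed citations (2 remaining named inputs: hLiu418 = stmt-HodgeConjecture-24832, h413 = stmt-HodgeConjecture-24833) until rung 0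
closes; count-neutral, nothing printed is asserted — Serre V §3 Cor. 3 PROVED for `ℓ = 2` in datum currency.

## References
* [Serre1979] J.-P. Serre, *Local Fields*, GTM 67 (1979): Ch. V §3 Prop. 5 (iii), Cor. 2, Cor. 3 pp. 85–87 (`U_K ∕ N U_L` cyclic of order `ℓ` for a totally ramified cyclic
  extension of prime degree `ℓ`), Ch. III §3 Prop. 7 (trace images), Ch. XV §2.
* [NeukirchANT1999] J. Neukirch, *Algebraic Number Theory* (1999): Ch. V (1.3) (the local norm index equals the degree for abelian extensions).
-/

set_option autoImplicit false

open WithZero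
open scoped Valued

namespace Literature.NumberTheory.LocalFields.WildQuadraticDatum

open Literature.NumberTheory.Automorphic.UnitaryThreeFourFrame

variable {K : Type*} [Field K] [Valued K ℤᵐ⁰] {σ : K →+* K} {ϖ : K} {d t : ℕ}

/-! ## §1 The break-level trace coefficient is a unit: `|Tr(ϖⁿ)| = |ϖσϖ|ⁿ` for `d = n + 1` -/

/-- **`|ϖⁿ + σ(ϖⁿ)| = exp(−2n)` EXACTLY at the break `n = d − 1`** (Serre V §3 Prop. 5 (iii): the break-level graded norm map is `ξ ↦ ξ^p − η^{p−1}ξ` with `η ≠ 0`): the trace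
is ONTO `𝔭_F^{d−1}` on `𝔭_E^{d−1}` (★ `exists_v_le_add_map_eq`, Serre III §3 Prop. 7), and `𝔭_E^{d−1} = 𝒪_F·ϖ^{d−1} + 𝔭_E^{d}` with `Tr 𝔭_E^{d} ⊆ 𝔭_F^{d}` (★ `v_add_map_le_exp`), so the
preimage of `πⁿ` has a UNIT fixed coefficient on `ϖⁿ` and `Tr(ϖⁿ)` cannot drop below `|π|ⁿ`. [cite: Serre1979, Ch. V §3 Prop. 5 (iii)] [cite: Serre1979, Ch. III §3 Prop. 7] -/
theorem v_add_map_varpi_pow_eq_at_break (hσ : ∀ x, σ (σ x) = x) (hvσ : ∀ a, Valued.v (σ a) = Valued.v a)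
    (hfix : ∀ x : K, σ x = x → x ≠ 0 → ∃ n : ℤ, Valued.v x = exp (2 * n)) (hϖ : Valued.v ϖ = exp (-1 : ℤ))
    (hd : Valued.v (ϖ - σ ϖ) = Valued.v ϖ ^ d) (ht : Valued.v (2 : K) = Valued.v ϖ ^ t) {n : ℕ} (hn : n + 1 = d) :
    Valued.v (ϖ ^ n + σ (ϖ ^ n)) = exp (-(2 * (n : ℤ))) := by
  have hϖn : Valued.v (ϖ ^ n) = exp (-(n : ℤ)) := by rw [map_pow, v_varpi_pow hϖ]
  have hϖn0 : ϖ ^ n ≠ 0 := (Valuation.ne_zero_iff _).1 (by rw [hϖn]; exact exp_ne_zero)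
  have hπn : Valued.v ((ϖ * σ ϖ) ^ n) = exp (-(2 * (n : ℤ))) := v_normVarpi_pow hvσ hϖ n
  have hσπn : σ ((ϖ * σ ϖ) ^ n) = (ϖ * σ ϖ) ^ n := by rw [map_pow, map_mul_map hσ]
  -- upper bound (trace image)
  have hA : Valued.v (ϖ ^ n + σ (ϖ ^ n)) ≤ exp (-(2 * (n : ℤ))) :=
    v_add_map_le_exp hσ hfix hϖ hd ht (x := ϖ ^ n) (j := n) (m := n) hϖn.le (by omega)
  -- a preimage `g` of `πⁿ` in `𝔭_E^{n}`
  obtain ⟨g, hg, hgtr⟩ := exists_v_le_add_map_eq hσ hfix hϖ hd ht hσπn (j := n) (m := n) hπn.le (by omega)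
  -- `g ∕ ϖⁿ = a + e`, `a` fixed, `|e| ≤ |ϖ|`
  have hg1 : Valued.v (g / ϖ ^ n) ≤ 1 := by
    rw [map_div₀, hϖn, div_le_iff₀ (zero_lt_iff.2 exp_ne_zero), one_mul]; exact hg
  obtain ⟨a, hσa, ha1, hea⟩ := exists_fixed_v_sub_le hσ hfix hϖ hd hg1
  set e : K := g / ϖ ^ n - a with he
  have hgae : g = a * ϖ ^ n + e * ϖ ^ n := by rw [he]; field_simp; ring
  -- `Tr(e·ϖⁿ)` lies one level deeper
  have heϖ : Valued.v (e * ϖ ^ n) ≤ exp (-((n : ℤ) + 1)) := by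
    rw [map_mul, hϖn]
    calc Valued.v e * exp (-(n : ℤ)) ≤ exp (-1 : ℤ) * exp (-(n : ℤ)) := mul_le_mul_left hea _
      _ = exp (-((n : ℤ) + 1)) := by rw [← exp_add]; congr 1; ring
  have htre : Valued.v (e * ϖ ^ n + σ (e * ϖ ^ n)) ≤ exp (-(2 * ((n : ℤ) + 1))) :=
    v_add_map_le_exp hσ hfix hϖ hd ht (j := (n : ℤ) + 1) (m := (n : ℤ) + 1) heϖ (by omega)
  -- `πⁿ = a·Tr(ϖⁿ) + Tr(eϖⁿ)`
  have hsplit : (ϖ * σ ϖ) ^ n = a * (ϖ ^ n + σ (ϖ ^ n)) + (e * ϖ ^ n + σ (e * ϖ ^ n)) := by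
    rw [← hgtr, hgae, map_add, map_mul, map_mul, hσa]; ring
  refine le_antisymm hA (not_lt.1 fun hlt => ?_)
  have h1 : Valued.v (a * (ϖ ^ n + σ (ϖ ^ n))) < exp (-(2 * (n : ℤ))) := by
    rw [map_mul]
    calc Valued.v a * Valued.v (ϖ ^ n + σ (ϖ ^ n)) ≤ 1 * Valued.v (ϖ ^ n + σ (ϖ ^ n)) := mul_le_mul_left ha1 _
      _ < exp (-(2 * (n : ℤ))) := by rw [one_mul]; exact hlt
  have h2 : Valued.v (e * ϖ ^ n + σ (e * ϖ ^ n)) < exp (-(2 * (n : ℤ))) :=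
    lt_of_le_of_lt htre (by rw [exp_lt_exp]; omega)
  have h := Valued.v.map_add_lt h1 h2
  rw [← hsplit, hπn] at h
  exact lt_irrefl _ h

/-! ## §2 Wild places: a fixed unit `1 + w·(ϖσϖ)^{d−1}` off the image of `ȳ ↦ ȳ² + λ̄ȳ` is not a norm -/

/-- **A σ-FIXED UNIT WHICH IS NOT A NORM, AT A WILD PLACE** (`|2| < 1`; Serre V §3 Cor. 3 for `ℓ = p = 2`: `[U_F : N U_E] ≥ 2`): for a ramified quadratic datum over a field with
finite residue field there is a `σ`-fixed unit `u` with `zσz ≠ u` for every `z`.  `u := 1 + w·(ϖσϖ)ⁿ` (`n = d − 1`) with `w̄` OFF the image of the additive residue map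
`ȳ ↦ ȳ² + λ̄ȳ`, `λ = Tr(ϖⁿ)∕(ϖσϖ)ⁿ` a unit by §1 (so the map kills `λ̄` and misses a residue); a would-be `z` is `≡ 1 (mod 𝔪)`, sits at level `≥ n` (below the break `|N z − 1| =
|z − 1|²`), and at level `n` its leading coefficient `a` would give `w̄ = ā² + λ̄ā`.  No completeness. [cite: Serre1979, Ch. V §3 Prop. 5 (iii), Cor. 3] [cite: NeukirchANT1999, Ch. V (1.3)] -/
theorem exists_fixed_unit_not_norm_of_v_two_lt_one {K : Type} [Field K] [Valued K ℤᵐ⁰] [Finite 𝓀[K]]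
    (σ : K →+* K) (ϖ : K) (d t : ℕ) (hD : IsRamifiedQuadraticDatum σ ϖ d t) (h2v : Valued.v (2 : K) < 1) :
    ∃ u : K, σ u = u ∧ Valued.v u = 1 ∧ ¬ ∃ z : K, z * σ z = u := by
  obtain ⟨hσ, hvσ, hϖ, hfix, hd, -, ht⟩ := hD
  have hϖ1 : exp (-1 : ℤ) < (1 : ℤᵐ⁰) := by rw [← exp_zero, exp_lt_exp]; norm_num
  -- at a wild place `d ≥ 2`
  have hd2 : 2 ≤ d := by
    by_contra hlt
    have hd0 : d ≠ 0 := fun h => by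
      rw [h, pow_zero] at hd
      have h1 : Valued.v (ϖ - σ ϖ) ≤ max (Valued.v ϖ) (Valued.v (σ ϖ)) := Valuation.map_sub _ _ _
      rw [hvσ, max_self, hd, hϖ, ← exp_zero, exp_le_exp] at h1
      omega
    have hodd : Odd d := ⟨0, by omega⟩
    have hdt := eq_succ_of_odd hσ hfix hϖ hd ht hodd
    have ht0 : t = 0 := by omega
    rw [ht, ht0, pow_zero] at h2v
    exact lt_irrefl _ h2v
  obtain ⟨n, hn⟩ : ∃ n : ℕ, n + 1 = d := ⟨d - 1, by omega⟩
  -- `πⁿ`, the unit trace coefficient `λ`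
  have hϖn : Valued.v (ϖ ^ n) = exp (-(n : ℤ)) := by rw [map_pow, v_varpi_pow hϖ]
  have hϖn0 : ϖ ^ n ≠ 0 := (Valuation.ne_zero_iff _).1 (by rw [hϖn]; exact exp_ne_zero)
  have hπn : Valued.v ((ϖ * σ ϖ) ^ n) = exp (-(2 * (n : ℤ))) := v_normVarpi_pow hvσ hϖ n
  have hπn0 : (ϖ * σ ϖ) ^ n ≠ 0 := (Valuation.ne_zero_iff _).1 (by rw [hπn]; exact exp_ne_zero)
  have hσπn : σ ((ϖ * σ ϖ) ^ n) = (ϖ * σ ϖ) ^ n := by rw [map_pow, map_mul_map hσ]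
  have hπn1 : Valued.v ((ϖ * σ ϖ) ^ n) < 1 := by rw [hπn, ← exp_zero, exp_lt_exp]; omega
  have hA : Valued.v (ϖ ^ n + σ (ϖ ^ n)) = exp (-(2 * (n : ℤ))) := v_add_map_varpi_pow_eq_at_break hσ hvσ hfix hϖ hd ht hn
  have hσA : σ (ϖ ^ n + σ (ϖ ^ n)) = ϖ ^ n + σ (ϖ ^ n) := map_add_map_eq_self hσ _
  set lam : K := (ϖ ^ n + σ (ϖ ^ n)) / (ϖ * σ ϖ) ^ n with hlamdef
  have hσlam : σ lam = lam := by rw [hlamdef, map_div₀, hσA, hσπn]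
  have hvlam : Valued.v lam = 1 := by rw [hlamdef, map_div₀, hA, hπn, div_self exp_ne_zero]
  -- residue field of characteristic two; `λ̄ ≠ 0`
  have h2M : (2 : 𝒪[K]) ∈ 𝓂[K] := (mem_maximalIdeal_iff_v_lt_one _).2 (by exact_mod_cast h2v)
  haveI : CharP 𝓀[K] 2 := by
    refine CharTwo.of_one_ne_zero_of_two_eq_zero one_ne_zero ?_
    have h := (IsLocalRing.residue_eq_zero_iff (2 : 𝒪[K])).2 h2M
    rwa [map_ofNat] at h
  set lamO : 𝒪[K] := ⟨lam, (Valuation.mem_integer_iff _ _).2 hvlam.le⟩ with hlamO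
  have hlambar : IsLocalRing.residue 𝒪[K] lamO ≠ 0 := by
    rw [Ne, IsLocalRing.residue_eq_zero_iff, mem_maximalIdeal_iff_v_lt_one, not_lt]
    exact hvlam.symm.le
  -- the residue map `ȳ ↦ ȳ² + λ̄ȳ` is not onto
  obtain ⟨wbar, hwbar⟩ : ∃ wbar : 𝓀[K], ∀ y : 𝓀[K], y * y + IsLocalRing.residue 𝒪[K] lamO * y ≠ wbar := by
    suffices hns : ¬ Function.Surjective (fun y : 𝓀[K] => y * y + IsLocalRing.residue 𝒪[K] lamO * y) by
      rw [Function.Surjective, not_forall] at hns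
      obtain ⟨wbar, hw⟩ := hns
      exact ⟨wbar, fun y hy => hw ⟨y, hy⟩⟩
    intro hsurj
    have hinj := Finite.injective_iff_surjective.2 hsurj
    have h0 : (fun y : 𝓀[K] => y * y + IsLocalRing.residue 𝒪[K] lamO * y) (IsLocalRing.residue 𝒪[K] lamO) =
        (fun y : 𝓀[K] => y * y + IsLocalRing.residue 𝒪[K] lamO * y) 0 := by
      have h2 : (2 : 𝓀[K]) = 0 := CharTwo.two_eq_zero
      simp only [mul_zero, add_zero]
      linear_combination (IsLocalRing.residue 𝒪[K] lamO * IsLocalRing.residue 𝒪[K] lamO) * h2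
    exact hlambar (hinj h0)
  -- a fixed integer `w` with residue `w̄`
  obtain ⟨wO, hwO⟩ := IsLocalRing.residue_surjective wbar
  obtain ⟨w, hσw, hw1, hwapprox⟩ := exists_fixed_v_sub_le hσ hfix hϖ hd (x := (wO : K)) ((Valuation.mem_integer_iff _ _).1 wO.2)
  set wO' : 𝒪[K] := ⟨w, (Valuation.mem_integer_iff _ _).2 hw1⟩ with hwO'
  have hwres : IsLocalRing.residue 𝒪[K] wO' = wbar := by
    rw [← hwO]; exact (residue_eq_of_v_sub_lt_one wO wO' (lt_of_le_of_lt hwapprox hϖ1)).symm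
  -- `u := 1 + w·πⁿ`
  have hu1' : Valued.v (w * (ϖ * σ ϖ) ^ n) < 1 := by
    rw [map_mul]
    calc Valued.v w * Valued.v ((ϖ * σ ϖ) ^ n) ≤ 1 * Valued.v ((ϖ * σ ϖ) ^ n) := mul_le_mul_left hw1 _
      _ < 1 := by rw [one_mul]; exact hπn1
  refine ⟨1 + w * (ϖ * σ ϖ) ^ n, by rw [map_add, map_one, map_mul, hσw, hσπn], Valued.v.map_one_add_of_lt hu1', ?_⟩
  rintro ⟨z, hz⟩
  -- (a) `|z| = 1`
  have hvN : Valued.v (z * σ z) = 1 := by rw [hz]; exact Valued.v.map_one_add_of_lt hu1'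
  have hvz : Valued.v z = 1 := v_eq_one_of_v_mul_map_eq_one hvσ hvN
  -- generic expansion: for `|y| ≤ 1` with fixed part `b` (`y = b + f`, `|f| ≤ |ϖ|`), `|N y − b²| ≤ exp(−2)`
  have hexpand : ∀ y b : K, σ b = b → Valued.v b ≤ 1 → Valued.v (y - b) ≤ exp (-1 : ℤ) →
      Valued.v (y * σ y - b * b) ≤ exp (-2 : ℤ) := by
    intro y b hσb hb1 hyb
    have htrf : Valued.v ((y - b) + σ (y - b)) ≤ exp (-(2 * (1 : ℤ))) :=
      v_add_map_le_exp hσ hfix hϖ hd ht (j := 1) (m := 1) (by simpa using hyb) (by omega)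
    have hNf : Valued.v ((y - b) * σ (y - b)) ≤ exp (-2 : ℤ) := by
      rw [map_mul, hvσ]
      calc Valued.v (y - b) * Valued.v (y - b) ≤ exp (-1 : ℤ) * exp (-1 : ℤ) := mul_le_mul' hyb hyb
        _ = exp (-2 : ℤ) := by rw [← exp_add]; norm_num
    have hrew : y * σ y - b * b = b * ((y - b) + σ (y - b)) + (y - b) * σ (y - b) := by
      rw [map_sub, hσb]; ring
    rw [hrew]
    refine Valued.v.map_add_le ?_ hNf
    rw [map_mul]
    calc Valued.v b * Valued.v ((y - b) + σ (y - b)) ≤ 1 * exp (-(2 * (1 : ℤ))) := mul_le_mul' hb1 htrf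
      _ = exp (-2 : ℤ) := by rw [one_mul]; norm_num
  -- (b) `z ≡ 1 (mod 𝔪)`
  have hz1 : Valued.v (z - 1) < 1 := by
    obtain ⟨a₀, hσa₀, ha₀1, hza₀⟩ := exists_fixed_v_sub_le hσ hfix hϖ hd hvz.le
    have hN : Valued.v (z * σ z - a₀ * a₀) ≤ exp (-2 : ℤ) := hexpand z a₀ hσa₀ ha₀1 hza₀
    -- `a₀² − 1 = (N z − 1) − (N z − a₀²)` has valuation `< 1`
    have hsq : Valued.v (a₀ * a₀ - 1) < 1 := by
      have hrew : a₀ * a₀ - 1 = w * (ϖ * σ ϖ) ^ n - (z * σ z - a₀ * a₀) := by rw [hz]; ring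
      rw [hrew]
      exact Valued.v.map_sub_lt hu1' (lt_of_le_of_lt hN (by rw [← exp_zero, exp_lt_exp]; norm_num))
    -- in residue characteristic two: `(a₀ − 1)² = (a₀² − 1) − 2(a₀ − 1)`
    have hsq' : Valued.v ((a₀ - 1) * (a₀ - 1)) < 1 := by
      have hrew : (a₀ - 1) * (a₀ - 1) = (a₀ * a₀ - 1) - 2 * (a₀ - 1) := by ring
      rw [hrew]
      refine Valued.v.map_sub_lt hsq ?_
      rw [map_mul]
      calc Valued.v (2 : K) * Valued.v (a₀ - 1) ≤ Valued.v (2 : K) * 1 :=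
            mul_le_mul_right (Valued.v.map_sub_le ha₀1 Valued.v.map_one.le) _
        _ < 1 := by rw [mul_one]; exact h2v
    have ha₀lt : Valued.v (a₀ - 1) < 1 := by
      by_contra hge
      rw [not_lt] at hge
      rw [map_mul] at hsq'
      exact not_le.2 hsq' (one_le_mul hge hge)
    calc Valued.v (z - 1) = Valued.v ((z - a₀) + (a₀ - 1)) := by ring_nf
      _ < 1 := Valued.v.map_add_lt (lt_of_le_of_lt hza₀ hϖ1) ha₀lt
  -- (c) the level of `x := z − 1` is at least `n`
  set x : K := z - 1 with hxdef
  have hNz : z * σ z - 1 = (x + σ x) + x * σ x := by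
    rw [hxdef, map_sub, map_one]; ring
  have huN : (x + σ x) + x * σ x = w * (ϖ * σ ϖ) ^ n := by rw [← hNz, hz]; ring
  have hxle : Valued.v x ≤ exp (-(n : ℤ)) := by
    by_contra hgt
    rw [not_le] at hgt
    have hx0 : Valued.v x ≠ 0 := ne_of_gt (lt_of_le_of_lt zero_le hgt)
    set ex : ℤ := log (Valued.v x) with hex
    have hvx : Valued.v x = exp ex := (exp_log hx0).symm
    have hexlt : ex < 0 := by rw [← exp_lt_exp, ← hvx, exp_zero]; exact hz1
    have hexgt : -(n : ℤ) < ex := by rw [← exp_lt_exp, ← hvx]; exact hgt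
    -- trace negligible below the break
    have htr : Valued.v (x + σ x) ≤ exp (-(2 * (-ex + 1))) :=
      v_add_map_le_exp hσ hfix hϖ hd ht (j := -ex) (m := -ex + 1) (by rw [neg_neg, hvx]) (by omega)
    have hNx : Valued.v (x * σ x) = exp (2 * ex) := by rw [map_mul, hvσ, hvx, ← exp_add, two_mul]
    have hdom : Valued.v (x + σ x) < Valued.v (x * σ x) := by
      rw [hNx]; exact lt_of_le_of_lt htr (by rw [exp_lt_exp]; omega)
    have hsum : Valued.v ((x + σ x) + x * σ x) = exp (2 * ex) := by
      rw [Valuation.map_add_eq_of_lt_right _ hdom, hNx]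
    rw [huN, map_mul, hπn] at hsum
    have hle : exp (2 * ex) ≤ exp (-(2 * (n : ℤ))) := by
      rw [← hsum]
      calc Valued.v w * exp (-(2 * (n : ℤ))) ≤ 1 * exp (-(2 * (n : ℤ))) := mul_le_mul_left hw1 _
        _ = exp (-(2 * (n : ℤ))) := one_mul _
    rw [exp_le_exp] at hle
    omega
  -- (d) at the break: `x = (a + e)·ϖⁿ` with `a` fixed, `|e| ≤ |ϖ|`
  have hy1 : Valued.v (x / ϖ ^ n) ≤ 1 := by
    rw [map_div₀, hϖn, div_le_iff₀ (zero_lt_iff.2 exp_ne_zero), one_mul]; exact hxle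
  obtain ⟨a, hσa, ha1, hea⟩ := exists_fixed_v_sub_le hσ hfix hϖ hd hy1
  set e : K := x / ϖ ^ n - a with he
  have hxae : x = (a + e) * ϖ ^ n := by rw [he]; field_simp; ring
  -- trace part: `Tr x = a·Tr(ϖⁿ) + Tr(eϖⁿ)`, `|Tr(eϖⁿ)| ≤ exp(−2n−2)`
  have heϖ : Valued.v (e * ϖ ^ n) ≤ exp (-((n : ℤ) + 1)) := by
    rw [map_mul, hϖn]
    calc Valued.v e * exp (-(n : ℤ)) ≤ exp (-1 : ℤ) * exp (-(n : ℤ)) := mul_le_mul_left hea _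
      _ = exp (-((n : ℤ) + 1)) := by rw [← exp_add]; congr 1; ring
  have htre : Valued.v (e * ϖ ^ n + σ (e * ϖ ^ n)) ≤ exp (-(2 * ((n : ℤ) + 1))) :=
    v_add_map_le_exp hσ hfix hϖ hd ht (j := (n : ℤ) + 1) (m := (n : ℤ) + 1) heϖ (by omega)
  -- norm part: `N x = N(a + e)·πⁿ`, `|N(a + e) − a²| ≤ exp(−2)`
  have hNae : Valued.v ((a + e) * σ (a + e) - a * a) ≤ exp (-2 : ℤ) :=
    hexpand (a + e) a hσa ha1 (by rw [add_sub_cancel_left]; exact hea)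
  -- the identity `w·πⁿ = a·Tr(ϖⁿ) + a²·πⁿ + R`, `R = Tr(eϖⁿ) + (N(a+e) − a²)·πⁿ`
  have hR : w * (ϖ * σ ϖ) ^ n - (a * (ϖ ^ n + σ (ϖ ^ n)) + a * a * (ϖ * σ ϖ) ^ n) =
      (e * ϖ ^ n + σ (e * ϖ ^ n)) + ((a + e) * σ (a + e) - a * a) * (ϖ * σ ϖ) ^ n := by
    rw [← huN, hxae]
    simp only [map_mul, map_add, map_pow, hσa, mul_pow]
    ring
  have hRv : Valued.v (w * (ϖ * σ ϖ) ^ n - (a * (ϖ ^ n + σ (ϖ ^ n)) + a * a * (ϖ * σ ϖ) ^ n)) ≤ exp (-(2 * (n : ℤ) + 2)) := by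
    rw [hR]
    refine Valued.v.map_add_le (le_trans htre (by rw [exp_le_exp]; omega)) ?_
    rw [map_mul, hπn]
    calc Valued.v ((a + e) * σ (a + e) - a * a) * exp (-(2 * (n : ℤ))) ≤ exp (-2 : ℤ) * exp (-(2 * (n : ℤ))) := mul_le_mul_left hNae _
      _ = exp (-(2 * (n : ℤ) + 2)) := by rw [← exp_add]; congr 1; ring
  -- divide by `πⁿ`: `|w − (a² + λa)| < 1`
  have hkey : Valued.v (w - (a * a + lam * a)) < 1 := by
    have hrew : w - (a * a + lam * a) = (w * (ϖ * σ ϖ) ^ n - (a * (ϖ ^ n + σ (ϖ ^ n)) + a * a * (ϖ * σ ϖ) ^ n)) / (ϖ * σ ϖ) ^ n := by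
      rw [hlamdef]; field_simp; ring
    rw [hrew, map_div₀, hπn, div_lt_iff₀ (zero_lt_iff.2 exp_ne_zero), one_mul]
    exact lt_of_le_of_lt hRv (by rw [exp_lt_exp]; omega)
  -- residues: `w̄ = ā² + λ̄ā`, contradiction
  set aO : 𝒪[K] := ⟨a, (Valuation.mem_integer_iff _ _).2 ha1⟩ with haO
  have hres : IsLocalRing.residue 𝒪[K] wO' = IsLocalRing.residue 𝒪[K] (aO * aO + lamO * aO) :=
    residue_eq_of_v_sub_lt_one wO' (aO * aO + lamO * aO) (by push_cast [hwO', haO, hlamO]; exact hkey)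
  refine hwbar (IsLocalRing.residue 𝒪[K] aO) ?_
  rw [← hwres, hres, map_add, map_mul, map_mul]

/-! ## §3 Tame places: the non-square fixed unit of ★ B-p10, lifted from `𝒪[K]` to `K` -/

/-- **A σ-FIXED UNIT WHICH IS NOT A NORM, AT A TAME PLACE** (`|2| = 1`; Serre V §3 Cor. 2: `N U_E = {u ∈ U_F : ū ∈ 𝓀ˣ²}` is proper): `σ` restricts to a residually trivial
involution of the complete local ring `𝒪[K]` and ★ `RamifiedQuadraticNorm.exists_fixed_isUnit_not_exists_mul_map_eq` gives a fixed unit `η` of non-square residue with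
`sσs ≠ η` on `𝒪[K]`; a solution in `K` would be integral (`|z|² = |η| = 1`). [cite: Serre1979, Ch. V §3 Prop. 5, Cor. 2] -/
theorem exists_fixed_unit_not_norm_of_v_two_eq_one {K : Type} [Field K] [Valued K ℤᵐ⁰] [IsAdicComplete 𝓂[K] 𝒪[K]] [Finite 𝓀[K]]
    (σ : K →+* K) (ϖ : K) (d t : ℕ) (hD : IsRamifiedQuadraticDatum σ ϖ d t) (h2 : Valued.v (2 : K) = 1) :
    ∃ u : K, σ u = u ∧ Valued.v u = 1 ∧ ¬ ∃ z : K, z * σ z = u := by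
  obtain ⟨hσ, hvσ, hϖ, hfix, hd, -, -⟩ := hD
  have hϖ1 : exp (-1 : ℤ) < (1 : ℤᵐ⁰) := by rw [← exp_zero, exp_lt_exp]; norm_num
  have hσO : ∀ x : 𝒪[K], σ (x : K) ∈ 𝒪[K] := fun x =>
    (Valuation.mem_integer_iff _ _).2 (by rw [hvσ]; exact (Valuation.mem_integer_iff _ _).1 x.2)
  let σO : 𝒪[K] →+* 𝒪[K] := (σ.comp (𝒪[K]).subtype).codRestrict 𝒪[K] hσO
  have hσO' : ∀ x : 𝒪[K], ((σO x : 𝒪[K]) : K) = σ x := fun _ => rfl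
  have hσσ : ∀ x, σO (σO x) = x := fun x => Subtype.ext (by rw [hσO', hσO', hσ])
  have hres : ∀ x : 𝒪[K], σO x - x ∈ IsLocalRing.maximalIdeal 𝒪[K] := by
    intro x
    obtain ⟨a, hσa, -, hxa⟩ := exists_fixed_v_sub_le hσ hfix hϖ hd (x := (x : K)) ((Valuation.mem_integer_iff _ _).1 x.2)
    apply (mem_maximalIdeal_iff_v_lt_one _).2
    have hcoe : ((σO x - x : 𝒪[K]) : K) = σ ((x : K) - a) - ((x : K) - a) := by
      rw [AddSubgroupClass.coe_sub, hσO', map_sub, hσa]; ring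
    rw [hcoe]
    calc Valued.v (σ ((x : K) - a) - ((x : K) - a)) ≤ max (Valued.v (σ ((x : K) - a))) (Valued.v ((x : K) - a)) :=
          Valuation.map_sub _ _ _
      _ = Valued.v ((x : K) - a) := by rw [hvσ, max_self]
      _ < 1 := lt_of_le_of_lt hxa hϖ1
  have hint := Valuation.integer.integers (Valued.v : Valuation K ℤᵐ⁰)
  have h2O : IsUnit (2 : 𝒪[K]) := hint.isUnit_iff_valuation_eq_one.2 (by rw [map_ofNat]; exact h2)
  obtain ⟨η, hηu, hση, -, hηnot⟩ := RamifiedQuadraticNorm.exists_fixed_isUnit_not_exists_mul_map_eq σO hσσ hres h2O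
  have hvη : Valued.v (η : K) = 1 := hint.isUnit_iff_valuation_eq_one.1 hηu
  refine ⟨(η : K), by rw [← hσO', hση], hvη, ?_⟩
  rintro ⟨z, hz⟩
  have hvz : Valued.v z = 1 := v_eq_one_of_v_mul_map_eq_one hvσ (by rw [hz, hvη])
  refine hηnot ⟨⟨z, (Valuation.mem_integer_iff _ _).2 hvz.le⟩, Subtype.ext ?_⟩
  rw [Subring.coe_mul, hσO']
  exact hz

/-! ## §4 Every ramified quadratic datum -/

/-- **`[U_F : N U_E] ≥ 2` AT EVERY RAMIFIED QUADRATIC DATUM** over a field with `𝓂`-adically complete valuation ring and finite residue field: a `σ`-fixed unit which is not a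
norm `zσz` exists (`t = 0` tame §3, `t ≥ 1` wild §2 — the wild leg does not even use completeness). [cite: Serre1979, Ch. V §3 Cor. 2, Cor. 3] [cite: NeukirchANT1999, Ch. V (1.3)] -/
theorem exists_fixed_unit_not_norm_of_isRamifiedQuadraticDatum {K : Type} [Field K] [Valued K ℤᵐ⁰] [IsAdicComplete 𝓂[K] 𝒪[K]] [Finite 𝓀[K]]
    (σ : K →+* K) (ϖ : K) (d t : ℕ) (hD : IsRamifiedQuadraticDatum σ ϖ d t) :
    ∃ u : K, σ u = u ∧ Valued.v u = 1 ∧ ¬ ∃ z : K, z * σ z = u := by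
  have ht := hD.2.2.2.2.2.2
  rcases Nat.eq_zero_or_pos t with h0 | hpos
  · exact exists_fixed_unit_not_norm_of_v_two_eq_one σ ϖ d t hD (by rw [ht, h0, pow_zero])
  · refine exists_fixed_unit_not_norm_of_v_two_lt_one σ ϖ d t hD ?_
    rw [ht, v_varpi_pow hD.2.2.1, ← exp_zero, exp_lt_exp]
    omega

/-! ## §5 Index EXACTLY two: the NI2 witness is a non-norm (units, and all non-zero fixed elements) -/

/-- **`U_F = (N ∩ U_F) ⊔ c·(N ∩ U_F)` WITH `c ∉ N`** — INDEX EXACTLY TWO ON THE FIXED UNITS: the witness `c` of ★ `exists_unit_norm_dichotomy_of_isRamifiedQuadraticDatum` is NOT a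
norm (a non-norm `u₀` from §4 with `c·u₀ = N z` and `c = N y` would give `u₀ = N(z∕y)`).  This is the `hc : ¬ ∃ z, zσz = c` binder of the MS-road bricks M∕O.
[cite: Serre1979, Ch. V §3 Cor. 3] [cite: NeukirchANT1999, Ch. V (1.3)] -/
theorem exists_unit_nonnorm_dichotomy_of_isRamifiedQuadraticDatum {K : Type} [Field K] [Valued K ℤᵐ⁰] [IsAdicComplete 𝓂[K] 𝒪[K]] [Finite 𝓀[K]]
    (σ : K →+* K) (ϖ : K) (d t : ℕ) (hD : IsRamifiedQuadraticDatum σ ϖ d t) :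
    ∃ c : K, σ c = c ∧ Valued.v c = 1 ∧ (¬ ∃ z : K, z * σ z = c) ∧
      ∀ u : K, σ u = u → Valued.v u = 1 → (∃ z : K, z * σ z = u) ∨ ∃ z : K, z * σ z = c * u := by
  obtain ⟨c, hσc, hvc, hdich⟩ := exists_unit_norm_dichotomy_of_isRamifiedQuadraticDatum σ ϖ d t hD
  obtain ⟨u₀, hσu₀, hvu₀, hu₀⟩ := exists_fixed_unit_not_norm_of_isRamifiedQuadraticDatum σ ϖ d t hD
  refine ⟨c, hσc, hvc, ?_, hdich⟩
  rintro ⟨y, hy⟩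
  have hy0 : y ≠ 0 := by
    rintro rfl
    rw [zero_mul] at hy
    rw [← hy, map_zero] at hvc
    exact zero_ne_one hvc
  have hσy0 : σ y ≠ 0 := (map_ne_zero σ).2 hy0
  rcases hdich u₀ hσu₀ hvu₀ with h | ⟨z, hz⟩
  · exact hu₀ h
  · refine hu₀ ⟨z * y⁻¹, ?_⟩
    rw [← mul_map_mul_map, hz, ← hy, map_inv₀]
    field_simp

/-- **`[F^× : N(K^×)] = 2` ON THE NOSE, IN DATUM CURRENCY**: a `σ`-fixed unit `c` which is NOT a norm such that every non-zero `σ`-fixed `x` is a norm or `c·x` is — the units by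
`exists_unit_nonnorm_dichotomy_of_isRamifiedQuadraticDatum`, the rest by datum clause 4 (`|x| = exp(2m)`, `x·(ϖσϖ)^{m}` is a fixed unit, `(ϖσϖ)^m = N(ϖ^m)`).
[cite: Serre1979, Ch. V §3 Cor. 3] [cite: NeukirchANT1999, Ch. V (1.3)] -/
theorem exists_nonnorm_dichotomy_of_isRamifiedQuadraticDatum {K : Type} [Field K] [Valued K ℤᵐ⁰] [IsAdicComplete 𝓂[K] 𝒪[K]] [Finite 𝓀[K]]
    (σ : K →+* K) (ϖ : K) (d t : ℕ) (hD : IsRamifiedQuadraticDatum σ ϖ d t) :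
    ∃ c : K, σ c = c ∧ Valued.v c = 1 ∧ (¬ ∃ z : K, z * σ z = c) ∧
      ∀ x : K, σ x = x → x ≠ 0 → (∃ z : K, z * σ z = x) ∨ ∃ z : K, z * σ z = c * x := by
  have hD' := hD
  obtain ⟨hσ, hvσ, hϖ, hfix, -, -, -⟩ := hD'
  obtain ⟨c, hσc, hvc, hcn, hunits⟩ := exists_unit_nonnorm_dichotomy_of_isRamifiedQuadraticDatum σ ϖ d t hD
  refine ⟨c, hσc, hvc, hcn, fun x hσx hx0 => ?_⟩
  obtain ⟨m, hm⟩ := hfix x hσx hx0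
  have hϖ0 : ϖ ≠ 0 := fun h => by rw [h, map_zero] at hϖ; exact (exp_ne_zero hϖ.symm).elim
  have hσϖ0 : σ ϖ ≠ 0 := (map_ne_zero σ).2 hϖ0
  -- `u := x · (ϖσϖ)^m` is a fixed unit (`|x| = exp(2m)`, `|(ϖσϖ)^m| = exp(−2m)`)
  have hvπ : Valued.v ((ϖ * σ ϖ) ^ m) = exp (-(2 * m)) := by
    rw [map_zpow₀, map_mul, hvσ, hϖ, ← exp_add, ← exp_zsmul]
    congr 1; ring
  have hu1 : Valued.v (x * (ϖ * σ ϖ) ^ m) = 1 := by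
    rw [map_mul, hm, hvπ, ← exp_add, ← exp_zero]; congr 1; ring
  have hσu : σ (x * (ϖ * σ ϖ) ^ m) = x * (ϖ * σ ϖ) ^ m := by
    rw [map_mul, map_zpow₀, hσx, map_mul_map hσ]
  rcases hunits _ hσu hu1 with ⟨z, hz⟩ | ⟨z, hz⟩
  · refine Or.inl ⟨z * (ϖ ^ m)⁻¹, ?_⟩
    rw [← mul_map_mul_map, hz, map_inv₀, map_zpow₀, mul_zpow]
    field_simp
  · refine Or.inr ⟨z * (ϖ ^ m)⁻¹, ?_⟩
    rw [← mul_map_mul_map, hz, map_inv₀, map_zpow₀, mul_zpow]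
    field_simp

end Literature.NumberTheory.LocalFields.WildQuadraticDatum
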